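import Summits.AtomisticToContinuum.FouriersLaw.Theorems.ClosedConeSensitivity.Negative.TangentReduction

/-!
# Sketch (crux-ideate round 2, ideator 4) — typed targets for the TUBE-AMPLIFIER refutation line of
`ClosedConeSensitivity` (E3, stmt-AtomisticToContinuum-14059)

Defs only (no proofs). See `TubeAmplifier-ideator4.md` / `Ideas/hyperbolic-tube-amplifier.md`.

* `EndTubeAmplifier` — R1′ ∧ R2′ packaged, derivative-free: for every core energy `K ≥ K₀` there is a
  rate `Λ ≥ Λ₀ K^{1/4}` such that for every chain length `N` and time `t` a measurable TUBE set `B`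
  exists with Gibbs weight `≥ e^{-(c_K K + c_ε N + Λ t)} Z_N`, on which the corridor sites `k ≥ k₀`
  stay `ε`-cold on `[0,t]` and the tangent entry `∂_{p_0} q_1(Φ_t ·)` (Fatou/liminf form) is
  `≥ e^{Λ t}` — the escape-rate identity around the anti-phase end breather.
* `TangentRayBlowup'` — the refutation interface of `Cruxes/…/Disproof.lean` §4, restated verbatim
  (that file is not importable from here).
* The composition `EndTubeAmplifier → ColdPrecursorFloor → TangentRayBlowup'` is the cdisprove
  seat's target (R3′ + R4′ of the note); `ColdPrecursorFloor` is kept in prose there because its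
  honest form is an averaged (not pointwise) readout bound.
-/

noncomputable section

namespace Summit.AtomisticToContinuum.FouriersLaw.Cruxes.ClosedConeSensitivity.Ideator4

open MeasureTheory Filter Topology
open scoped NNReal ENNReal
open Literature.MathematicalPhysics.KineticTheory.HeatConduction
open Summit.AtomisticToContinuum.FouriersLaw.Theorems.ClosedConeSensitivity.Negative.ZeroFrictionDictionary

/-- The unnormalised Gibbs weight `μ_T = e^{-H_N/T} dq dp` of the closed chain (friction-free
member; `H` does not depend on `γ`). -/
def gibbsWeight (ω₂ lam β T : ℝ) (N : ℕ) : Measure (PhaseSpace N) :=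
  volume.withDensity fun x => ENNReal.ofReal (Real.exp (-((pinnedChain ω₂ lam β 0).hamiltonian N x) / T))

/-- Its mass `Z_N(T)`. -/
def partitionZ (ω₂ lam β T : ℝ) (N : ℕ) : ℝ :=
  ∫ x, Real.exp (-((pinnedChain ω₂ lam β 0).hamiltonian N x) / T) ∂volume

/-- Momentum kick `p_b ↦ p_b + s`. -/
def kick {N : ℕ} (b : Fin N) (s : ℝ) (x : PhaseSpace N) : PhaseSpace N :=
  (x.1, Function.update x.2 b (x.2 b + s))

/-- **EndTubeAmplifier** (R1′ ∧ R2′ of the note, packaged and derivative-free).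
`k₀` = number of core sites (3 for the anti-phase end breather incl. its slaved neighbour),
`ε` = corridor coldness, `cε` = Gibbs price per corridor site, `cK` = price per unit core energy,
`Λ₀ K^{1/4} ≤ Λ` = unstable Floquet rate of the scaled breather. The three clauses: tube weight
(escape rate: the shadowing cost is ONE factor `e^{-Λ t}`), cold corridor along the whole window
(supplied by the tube, no statistics), and growth `≥ e^{Λ t}` of the tangent entry
`∂_{p_0} q_1 ∘ Φ_t` in the same Fatou/liminf form as `TangentBoundAt`. -/
def EndTubeAmplifier (ω₂ lam β T : ℝ) : Prop :=
  ∃ (k₀ : ℕ) (ε cε cK Λ₀ K₀ : ℝ), 2 ≤ k₀ ∧ 0 < ε ∧ 0 < Λ₀ ∧ 0 < K₀ ∧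
    ∀ K : ℝ, K₀ ≤ K → ∃ Λ : ℝ, Λ₀ * K ^ (1 / 4 : ℝ) ≤ Λ ∧
      ∀ (N : ℕ) (hN : k₀ + 2 ≤ N) (t : ℝ), 0 ≤ t →
        ∃ B : Set (PhaseSpace N), MeasurableSet B ∧
          ENNReal.ofReal (Real.exp (-(cK * K + cε * N + Λ * t)) * partitionZ ω₂ lam β T N)
              ≤ gibbsWeight ω₂ lam β T N B ∧
          (∀ x ∈ B, ∀ s ∈ Set.Icc (0 : ℝ) t, ∀ k : Fin N, k₀ ≤ k.val →
              |(detFlow ω₂ lam β N s x).1 k| ≤ ε ∧ |(detFlow ω₂ lam β N s x).2 k| ≤ ε) ∧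
          (∀ x ∈ B, ENNReal.ofReal (Real.exp (Λ * t)) ≤
              Filter.liminf (fun n : ℕ => ENNReal.ofReal (((n : ℝ) + 1) *
                |(detFlow ω₂ lam β N t (kick ⟨0, by omega⟩ (1 / ((n : ℝ) + 1)) x)).1 ⟨1, by omega⟩ -
                  (detFlow ω₂ lam β N t x).1 ⟨1, by omega⟩|)) Filter.atTop)

/-- The refutation interface of `Cruxes/ClosedConeSensitivity/Disproof.lean` §4, restated verbatim:
blow-up of the normalised Gibbs mean square of the tangent entry `∂_{p_0}(j_d∘Φ_{a d})` along every
ray `t = a·d` (kick at the left contact). There, `closedConeSensitivity_false_of_rayBlowup` turns it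
into `¬ ClosedConeSensitivity` at one admissible parameter point. -/
def TangentRayBlowup' (ω₂ lam β T : ℝ) : Prop :=
  ∀ a : ℝ, 0 < a → ∀ C : ℝ, ∃ (N : ℕ) (i b : Fin N), b.val = 0 ∧
    ENNReal.ofReal (C * ∫ x, Real.exp (-((pinnedChain ω₂ lam β 0).hamiltonian N x) / T) ∂volume) <
      ∫⁻ x, Filter.liminf (fun n : ℕ => ENNReal.ofReal (((n : ℝ) + 1) ^ 2 *
          ((pinnedChain ω₂ lam β 0).bondCurrent N i
              (detFlow ω₂ lam β N (a * i.val) (x.1, Function.update x.2 b (x.2 b + 1 / ((n : ℝ) + 1)))) -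
            (pinnedChain ω₂ lam β 0).bondCurrent N i (detFlow ω₂ lam β N (a * i.val) x)) ^ 2)) Filter.atTop
        ∂(volume.withDensity fun x : PhaseSpace N =>
            ENNReal.ofReal (Real.exp (-((pinnedChain ω₂ lam β 0).hamiltonian N x) / T)))

/-- Shape of the cdisprove target (R3′ ∧ R4′ supply the proof): the tube amplifier at ONE parameter
point with small `ρ = β/lam` forces ray blow-up there. Recorded as a `Prop`-valued implication so the
file stays `sorry`-free; it is NOT claimed here. -/
def TubeRefutationTarget (ω₂ lam β T : ℝ) : Prop :=
  EndTubeAmplifier ω₂ lam β T → TangentRayBlowup' ω₂ lam β T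

/-- Sanity: the kick is the momentum translation used by the crux. -/
theorem kick_apply {N : ℕ} (b : Fin N) (s : ℝ) (x : PhaseSpace N) :
    kick b s x = (x.1, Function.update x.2 b (x.2 b + s)) := rfl

end Summit.AtomisticToContinuum.FouriersLaw.Cruxes.ClosedConeSensitivity.Ideator4
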